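import Literature.MathematicalPhysics.QuantumFieldTheory.WilsonFinTorusMagneticFluxSectors
import Literature.MathematicalPhysics.QuantumFieldTheory.WilsonFinTorusFluxSectorsPopulated
import HarnessLib

/-!
# Every electric flux is populated in EVERY magnetic sector: `0 < e^{−βF(e, m; a, β)}` on every finite box

Topic `Literature/MathematicalPhysics/QuantumFieldTheory`; sequel of `WilsonFinTorusMagneticFluxSectors.lean` ('t Hooft's
`e^{−βF(e,m)} = |Γ|⁻¹ Σ_k conj ψ(k) W{k, m}` is real and `≥ 0` in every magnetic sector — transfer-matrix positivity of the
magnetically twisted slice kernel `K^w_β = finTorusSliceKernelTw ρ β w`) and of `WilsonFinTorusFluxSectorsPopulated.lean` (the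
same population statement WITHOUT magnetic flux: Polyakov lines create electric flux, 't Hooft (4.6)–(4.10); the loop integral
`integral_prod_oneLinkWeight_mul_prod_trace_polyakov`; the one-link matrix `M(β)` with `tr(M(β)ⁿ ρ(g)) ≠ 0`).

THE POINT: the witness of the companion file, `u_S(b) = e^{+βS_sp(b)/2} · ∏ tr ρ(P_q b)` (half spatial weight times traced
Polyakov loops), is adapted to the magnetic sector by replacing `S_sp` with the TWISTED spatial energy `S^w_sp`: then the right
half-weight of `K^w_β` cancels exactly as before, the Gauss-law factor is the untwisted one, and one transfer step gives the
SAME loop integral `e^{−βS^w_sp(a)/2} ∫ ∏_l f_β(a_l b_l⁻¹) ∏ tr ρ(P_q b) db`, which does not vanish at a suitable slice — so the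
kernel-level criterion `Literature.Analysis.OperatorTheory.re_fluxSector_pos_of_covariant` applies verbatim to `K^w_β`.

Contents (all PROVED; no definition):

* `integral_finTorusSliceKernelTw_mul_exp_mul` — one twisted transfer step on `e^{βS^w/2}·W` for a continuous gauge-invariant `W`;
* `multiWitnessTw_finSliceTwist` — centre charge of the twisted multi-line witness (the twisted spatial weight is invariant);
* `not_ae_eq_zero_integral_finTorusSliceKernelTw_mul_multiWitness` — the twisted witness survives one twisted transfer step;
* ★ `wilsonFinTorusMagneticFluxPartition_re_pos_of_witness` ∕ `_of_lines` ∕ `_of_flux` ∕ `_of_mem_closure` — in EVERY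
  magnetic sector `zM` (arbitrary, `G`-valued): if `ρ` sees the temporal twist of direction `i` through `ψ_i`
  (`ρ(φ k i) = ψ_i(k)·1`), then `0 < Re Z_{n₀ψ₀+n₁ψ₁+n₂ψ₂, m}(M+2)` for `n₀ ≤ b₂b₃`, `n₁ ≤ b₁b₃`, `n₂ ≤ b₁b₂`, all `M`, and —
  given room `ord(ψ_i) ≤ (transverse area)_i + 1` — EVERY `χ` in the subgroup generated by `ψ₀, ψ₁, ψ₂` is populated;
  `β > 0`, `N ≥ 1`, all sides `≥ 1`;
* ★ `wilsonFinTorusFluxTransform_re_pos_of_flux` ∕ `_of_mem_closure` — for 't Hooft's object of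
  `WilsonFinTorusTHooftDuality.lean`: with `χ` the character by which `ρ` sees the centre-valued twist map `φ : Γ → Z(G)`
  (`ρ(φ k) = χ(k)·1`), **`0 < Re e^{−F}(n₀χ, n₁χ, n₂χ | m₁₂, m₀₂, m₀₁; a, b, c, M+2)`** for `n₀ ≤ bc`, `n₁ ≤ ac`, `n₂ ≤ ab`, EVERY
  magnetic flux, and (room `ord χ ≤ bc+1, ac+1, ab+1`) every electric flux `(ψ₀, ψ₁, ψ₂)` with `ψ_i ∈ ⟨χ⟩` — for `SU(N)`, the
  fundamental `ρ` and 't Hooft's `ℤ_N → Z(SU(N))`: EVERY `(e, m) ∈ ℤ_N³ × ℤ_N³` once `min(ab, ac, bc) ≥ N − 1`.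

HONEST FRAMING: one finite box at fixed `β`; this discharges the population hypothesis behind the finite-box statements about
`F(e, m)` (they are LEVELS of one box, the Hopf rate `→ 1` in the volume) and says nothing about `a_i → ∞` ('t Hooft §7–§8),
light∕heavy fluxes, duality consequences, an area law or a mass gap.  The Yang–Mills mass gap (Clay) is NOT proved by any of this;
R4 closes only the conditional finite-𝕋⁴ rung `BalabanLadder.UV`.  No `def`, no `instance`, no `sorry`; standard axioms.

References: G. 't Hooft, Nucl. Phys. B 153 (1979) 141, §4 (4.6)–(4.10), §5 (5.1)–(5.4); I. Montvay, G. Münster, *Quantum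
Fields on a Lattice* (1994) §3.2.6 (3.137)–(3.146), §3.2.8 (3.184)–(3.187); J. Greensite (2011) §4.4 (4.41)–(4.44).
-/

noncomputable section

open MeasureTheory Filter Function Finset Topology
open scoped ENNReal ComplexConjugate BigOperators Matrix
open Literature.Analysis.OperatorTheory Literature.RepresentationTheory.CompactGroups
open Literature.Barriers.QuantumFields

namespace Literature.MathematicalPhysics.QuantumFieldTheory

/-! ### One twisted transfer step on the twisted multi-line witness -/

section MultiWitness

variable {b₁ b₂ b₃ : ℕ} {G : Type*} [Group G] [TopologicalSpace G] [IsTopologicalGroup G] [CompactSpace G]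
  [MeasurableSpace G] [BorelSpace G] [SecondCountableTopology G] {N : ℕ} (ρ : G →* Matrix (Fin N) (Fin N) ℂ)

omit [SecondCountableTopology G] in
/-- The ordered product `M ρ(g) · M ⋯ M` of a line carrying `g` on its first link has trace `tr(M^{m+1} ρ(g))` (plumbing).
[cite: MontvayMunster1994, §3.2.8 (3.187)] -/
private theorem mgp_trace_prod_ofFn_oneLinkMatrix_mul_head (β : ℝ) {m : ℕ} (g : G) :
    ((List.ofFn fun k : Fin (m + 1) => oneLinkMatrix ρ β * ρ (if (k : ℕ) = 0 then g else 1)).prod).trace =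
      ((oneLinkMatrix ρ β) ^ (m + 1) * ρ g).trace := by
  have hprod : (List.ofFn fun k : Fin (m + 1) => oneLinkMatrix ρ β * ρ (if (k : ℕ) = 0 then g else 1)).prod =
      oneLinkMatrix ρ β * ρ g * (oneLinkMatrix ρ β) ^ m := by
    rw [List.ofFn_succ, List.prod_cons]
    simp [Fin.val_succ, List.ofFn_const, List.prod_replicate]
  rw [hprod, Matrix.trace_mul_cycle, pow_succ]

omit [CompactSpace G] [MeasurableSpace G] [BorelSpace G] [SecondCountableTopology G] in
/-- The twisted multi-line witness `u^w_S(b) = e^{β S^w_sp(b)/2} ∏ tr ρ(P_q b) ⋯` is continuous (plumbing). [folklore] -/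
private theorem mgp_continuous_multiWitnessTw (hρ : Continuous ρ) (β : ℝ) (w : FinSpatialSite b₁ b₂ b₃ → Fin 3 → Fin 3 → G)
    (S₀ : Finset (Fin b₂ × Fin b₃)) (S₁ : Finset (Fin b₁ × Fin b₃)) (S₂ : Finset (Fin b₁ × Fin b₂)) :
    Continuous fun b : FinSpatialSite b₁ b₂ b₃ × Fin 3 → G =>
      (Real.exp (β * finTorusSpatialActionTw ρ w b / 2) : ℂ) *
        ((∏ q ∈ S₀, (ρ (finSlicePolyakovHolonomy b q)).trace) *
          ((∏ q ∈ S₁, (ρ (finSlicePolyakovHolonomy₁ b q)).trace) *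
            ∏ q ∈ S₂, (ρ (finSlicePolyakovHolonomy₂ b q)).trace)) :=
  (Complex.continuous_ofReal.comp (Real.continuous_exp.comp ((continuous_const.mul
    (continuous_finTorusSpatialActionTw ρ hρ w)).div_const 2))).mul
    ((continuous_finsetProd _ fun q _ => (hρ.comp (continuous_finSlicePolyakovHolonomy q)).matrix_trace).mul
      ((continuous_finsetProd _ fun q _ => (hρ.comp (continuous_finSlicePolyakovHolonomy₁ q)).matrix_trace).mul
        (continuous_finsetProd _ fun q _ => (hρ.comp (continuous_finSlicePolyakovHolonomy₂ q)).matrix_trace)))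

omit [TopologicalSpace G] [IsTopologicalGroup G] [CompactSpace G] [MeasurableSpace G] [BorelSpace G]
  [SecondCountableTopology G] in
/-- The product of traced Polyakov loops is gauge invariant (plumbing). [cite: BorgsSeiler1983, §II.3 Lemma II.4 (p. 336)] -/
private theorem mgp_multiWitness_finSliceGaugeTransform [NeZero b₁] [NeZero b₂] [NeZero b₃]
    (S₀ : Finset (Fin b₂ × Fin b₃)) (S₁ : Finset (Fin b₁ × Fin b₃)) (S₂ : Finset (Fin b₁ × Fin b₂))
    (c : FinSpatialSite b₁ b₂ b₃ → G) (x : FinSpatialSite b₁ b₂ b₃ × Fin 3 → G) :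
    (∏ q ∈ S₀, (ρ (finSlicePolyakovHolonomy (finSliceGaugeTransform c x) q)).trace) *
        ((∏ q ∈ S₁, (ρ (finSlicePolyakovHolonomy₁ (finSliceGaugeTransform c x) q)).trace) *
          ∏ q ∈ S₂, (ρ (finSlicePolyakovHolonomy₂ (finSliceGaugeTransform c x) q)).trace) =
      (∏ q ∈ S₀, (ρ (finSlicePolyakovHolonomy x q)).trace) *
        ((∏ q ∈ S₁, (ρ (finSlicePolyakovHolonomy₁ x q)).trace) * ∏ q ∈ S₂, (ρ (finSlicePolyakovHolonomy₂ x q)).trace) := by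
  simp only [trace_rep_finSlicePolyakovHolonomy_finSliceGaugeTransform,
    trace_rep_finSlicePolyakovHolonomy₁_finSliceGaugeTransform, trace_rep_finSlicePolyakovHolonomy₂_finSliceGaugeTransform]

/-- **One TWISTED transfer step applied to `e^{β S^w_sp/2} · W` for a continuous gauge-invariant slice function `W`**:
`∫ K^w_β(a, b) e^{β S^w_sp(b)/2} W(b) db = e^{−β S^w_sp(a)/2} · ∫ ∏_l f_β(a_l b_l⁻¹) W(b) db` — the twisted half-weights at `b`
cancel, the (untwisted) Gauss-law average drops out against the gauge-invariant `W`, and the temporal weight factorises over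
links: the same loop integral as without magnetic flux. [cite: MontvayMunster1994, §3.2.6 (3.144) and §3.2.8 (3.184)]
[cite: tHooft1979Flux, §4 (4.6)–(4.8) and §5 (5.1)] -/
theorem integral_finTorusSliceKernelTw_mul_exp_mul (hρ : Continuous ρ) (β : ℝ)
    (w : FinSpatialSite b₁ b₂ b₃ → Fin 3 → Fin 3 → G)
    {W : (FinSpatialSite b₁ b₂ b₃ × Fin 3 → G) → ℂ} (hWc : Continuous W)
    (hWg : ∀ (c : FinSpatialSite b₁ b₂ b₃ → G) (x : FinSpatialSite b₁ b₂ b₃ × Fin 3 → G),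
      W (finSliceGaugeTransform c x) = W x)
    (a : FinSpatialSite b₁ b₂ b₃ × Fin 3 → G) :
    ∫ b, (finTorusSliceKernelTw ρ β w a b : ℂ) * ((Real.exp (β * finTorusSpatialActionTw ρ w b / 2) : ℂ) * W b)
        ∂(Measure.pi fun _ : FinSpatialSite b₁ b₂ b₃ × Fin 3 => haarProbability G) =
      (Real.exp (-(β * finTorusSpatialActionTw ρ w a / 2)) : ℂ) *
        ∫ b, (∏ l, (oneLinkWeight ρ β (a l * (b l)⁻¹) : ℂ)) * W b
          ∂(Measure.pi fun _ : FinSpatialSite b₁ b₂ b₃ × Fin 3 => haarProbability G) := by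
  have h1 : ∀ b : FinSpatialSite b₁ b₂ b₃ × Fin 3 → G, (finTorusSliceKernelTw ρ β w a b : ℂ) *
      ((Real.exp (β * finTorusSpatialActionTw ρ w b / 2) : ℂ) * W b) =
      (Real.exp (-(β * finTorusSpatialActionTw ρ w a / 2)) : ℂ) *
        (((∫ g, Real.exp (-(β * finTorusTemporalAction ρ a g b))
            ∂(Measure.pi fun _ : FinSpatialSite b₁ b₂ b₃ => haarProbability G) : ℝ) : ℂ) * W b) := fun b => by
    have hcancel : (Real.exp (-(β * finTorusSpatialActionTw ρ w b / 2)) : ℂ) *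
        (Real.exp (β * finTorusSpatialActionTw ρ w b / 2) : ℂ) = 1 := by
      rw [← Complex.ofReal_mul, ← Real.exp_add, neg_add_cancel, Real.exp_zero, Complex.ofReal_one]
    unfold finTorusSliceKernelTw
    rw [Complex.ofReal_mul, Complex.ofReal_mul]
    calc (Real.exp (-(β * finTorusSpatialActionTw ρ w a / 2)) : ℂ) *
          ((∫ g, Real.exp (-(β * finTorusTemporalAction ρ a g b))
            ∂(Measure.pi fun _ : FinSpatialSite b₁ b₂ b₃ => haarProbability G) : ℝ) : ℂ) *
          (Real.exp (-(β * finTorusSpatialActionTw ρ w b / 2)) : ℂ) *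
          ((Real.exp (β * finTorusSpatialActionTw ρ w b / 2) : ℂ) * W b)
        = (Real.exp (-(β * finTorusSpatialActionTw ρ w a / 2)) : ℂ) *
          ((∫ g, Real.exp (-(β * finTorusTemporalAction ρ a g b))
            ∂(Measure.pi fun _ : FinSpatialSite b₁ b₂ b₃ => haarProbability G) : ℝ) : ℂ) *
          ((Real.exp (-(β * finTorusSpatialActionTw ρ w b / 2)) : ℂ) *
            (Real.exp (β * finTorusSpatialActionTw ρ w b / 2) : ℂ)) * W b := by ring
      _ = _ := by rw [hcancel]; ring
  simp_rw [h1]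
  rw [integral_const_mul, integral_integral_exp_neg_finTorusTemporalAction_mul ρ hρ β hWc hWg a]
  congr 1
  refine integral_congr_ae (Eventually.of_forall fun b => ?_)
  dsimp only
  rw [exp_neg_finTorusTemporalAction_one_eq_prod, Complex.ofReal_prod]

omit [TopologicalSpace G] [IsTopologicalGroup G] [CompactSpace G] [MeasurableSpace G] [BorelSpace G]
  [SecondCountableTopology G] in
/-- **Centre charge of the twisted multi-line witness**: under a slice twist by `z` (central in the spatial directions, seen
by `ρ` through `ω i`), `u^w_S(T_z x) = ω₀^{|S₀|} ω₁^{|S₁|} ω₂^{|S₂|} · u^w_S(x)` — the twisted spatial weight is invariant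
(`finTorusSpatialActionTw_finSliceTwist`, every `w`), each traced loop along axis `i` acquires `ω i` ('t Hooft (4.8)–(4.9)).
[cite: tHooft1979Flux, §4 (4.8)–(4.10)] -/
theorem multiWitnessTw_finSliceTwist [NeZero b₁] [NeZero b₂] [NeZero b₃]
    {z : Fin 4 → G} (hz : ∀ i : Fin 3, z i.castSucc ∈ Subgroup.center G) {ω : Fin 3 → ℂ}
    (hω : ∀ i : Fin 3, ρ (z i.castSucc) = (ω i) • (1 : Matrix (Fin N) (Fin N) ℂ)) (β : ℝ)
    (w : FinSpatialSite b₁ b₂ b₃ → Fin 3 → Fin 3 → G)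
    (S₀ : Finset (Fin b₂ × Fin b₃)) (S₁ : Finset (Fin b₁ × Fin b₃)) (S₂ : Finset (Fin b₁ × Fin b₂))
    (x : FinSpatialSite b₁ b₂ b₃ × Fin 3 → G) :
    (Real.exp (β * finTorusSpatialActionTw ρ w (finSliceTwist z x) / 2) : ℂ) *
        ((∏ q ∈ S₀, (ρ (finSlicePolyakovHolonomy (finSliceTwist z x) q)).trace) *
          ((∏ q ∈ S₁, (ρ (finSlicePolyakovHolonomy₁ (finSliceTwist z x) q)).trace) *
            ∏ q ∈ S₂, (ρ (finSlicePolyakovHolonomy₂ (finSliceTwist z x) q)).trace)) =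
      (ω 0 ^ S₀.card * ω 1 ^ S₁.card * ω 2 ^ S₂.card) *
        ((Real.exp (β * finTorusSpatialActionTw ρ w x / 2) : ℂ) *
          ((∏ q ∈ S₀, (ρ (finSlicePolyakovHolonomy x q)).trace) *
            ((∏ q ∈ S₁, (ρ (finSlicePolyakovHolonomy₁ x q)).trace) *
              ∏ q ∈ S₂, (ρ (finSlicePolyakovHolonomy₂ x q)).trace))) := by
  have hω0 : ρ (z 0) = (ω 0) • (1 : Matrix (Fin N) (Fin N) ℂ) := hω 0
  have hω1 : ρ (z 1) = (ω 1) • (1 : Matrix (Fin N) (Fin N) ℂ) := hω 1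
  have hω2 : ρ (z 2) = (ω 2) • (1 : Matrix (Fin N) (Fin N) ℂ) := hω 2
  rw [finTorusSpatialActionTw_finSliceTwist ρ hz]
  simp only [trace_rep_finSlicePolyakovHolonomy_finSliceTwist ρ hω0, trace_rep_finSlicePolyakovHolonomy₁_finSliceTwist ρ hω1,
    trace_rep_finSlicePolyakovHolonomy₂_finSliceTwist ρ hω2, Finset.prod_mul_distrib, Finset.prod_const]
  ring

/-- ★ **The twisted multi-line witness survives one twisted transfer step**: for `β > 0`, `N ≥ 1`, all sides `≥ 1` and EVERY
spatial twist `w`, the function `a ↦ ∫ K^w_β(a, b) u^w_S(b) db` (`u^w_S` = twisted half spatial weight × the traced Polyakov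
loops through `S₀, S₁, S₂`) is continuous and non-zero at the slice carrying a suitable `g_i ∈ G` on every link of direction
`i` leaving the sheet `{p_i = 0}`, hence NOT a.e. zero — the same loop integral as without magnetic flux.
[cite: tHooft1979Flux, §4 (4.6)–(4.10)] [cite: MontvayMunster1994, §3.2.8 (3.184)–(3.187)] -/
theorem not_ae_eq_zero_integral_finTorusSliceKernelTw_mul_multiWitness (hρ : Continuous ρ)
    (hρu : ∀ g, ρ g ∈ Matrix.unitaryGroup (Fin N) ℂ) [NeZero N] [NeZero b₁] [NeZero b₂] [NeZero b₃] {β : ℝ}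
    (hβ : 0 < β) (w : FinSpatialSite b₁ b₂ b₃ → Fin 3 → Fin 3 → G)
    (S₀ : Finset (Fin b₂ × Fin b₃)) (S₁ : Finset (Fin b₁ × Fin b₃)) (S₂ : Finset (Fin b₁ × Fin b₂)) :
    ¬ ((fun a : FinSpatialSite b₁ b₂ b₃ × Fin 3 → G => ∫ b, (finTorusSliceKernelTw ρ β w a b : ℂ) *
        ((Real.exp (β * finTorusSpatialActionTw ρ w b / 2) : ℂ) *
          ((∏ q ∈ S₀, (ρ (finSlicePolyakovHolonomy b q)).trace) *
            ((∏ q ∈ S₁, (ρ (finSlicePolyakovHolonomy₁ b q)).trace) *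
              ∏ q ∈ S₂, (ρ (finSlicePolyakovHolonomy₂ b q)).trace)))
        ∂(Measure.pi fun _ : FinSpatialSite b₁ b₂ b₃ × Fin 3 => haarProbability G))
        =ᵐ[Measure.pi fun _ : FinSpatialSite b₁ b₂ b₃ × Fin 3 => haarProbability G] 0) := by
  set μS : Measure (FinSpatialSite b₁ b₂ b₃ × Fin 3 → G) := Measure.pi fun _ => haarProbability G with hμS
  -- the gauge-invariant part of the witness
  set W : (FinSpatialSite b₁ b₂ b₃ × Fin 3 → G) → ℂ := fun b =>
    (∏ q ∈ S₀, (ρ (finSlicePolyakovHolonomy b q)).trace) *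
      ((∏ q ∈ S₁, (ρ (finSlicePolyakovHolonomy₁ b q)).trace) * ∏ q ∈ S₂, (ρ (finSlicePolyakovHolonomy₂ b q)).trace)
    with hW
  have hWc : Continuous W :=
    (continuous_finsetProd _ fun q _ => (hρ.comp (continuous_finSlicePolyakovHolonomy q)).matrix_trace).mul
      ((continuous_finsetProd _ fun q _ => (hρ.comp (continuous_finSlicePolyakovHolonomy₁ q)).matrix_trace).mul
        (continuous_finsetProd _ fun q _ => (hρ.comp (continuous_finSlicePolyakovHolonomy₂ q)).matrix_trace))
  have hWg : ∀ (c : FinSpatialSite b₁ b₂ b₃ → G) (x : FinSpatialSite b₁ b₂ b₃ × Fin 3 → G),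
      W (finSliceGaugeTransform c x) = W x := fun c x => mgp_multiWitness_finSliceGaugeTransform ρ S₀ S₁ S₂ c x
  -- the special slice: `g i` on every link of direction `i` leaving the sheet `{p_i = 0}`
  obtain ⟨m₁, hm₁⟩ := Nat.exists_eq_succ_of_ne_zero (NeZero.ne b₁)
  obtain ⟨m₂, hm₂⟩ := Nat.exists_eq_succ_of_ne_zero (NeZero.ne b₂)
  obtain ⟨m₃, hm₃⟩ := Nat.exists_eq_succ_of_ne_zero (NeZero.ne b₃)
  obtain ⟨g₀, hg₀⟩ := exists_trace_oneLinkMatrix_pow_mul_rep_ne_zero ρ hρ hρu hβ b₁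
  obtain ⟨g₁, hg₁⟩ := exists_trace_oneLinkMatrix_pow_mul_rep_ne_zero ρ hρ hρu hβ b₂
  obtain ⟨g₂, hg₂⟩ := exists_trace_oneLinkMatrix_pow_mul_rep_ne_zero ρ hρ hρu hβ b₃
  set a₀ : FinSpatialSite b₁ b₂ b₃ × Fin 3 → G := fun l =>
    if finSpatialCoord l.1 l.2 = 0 then (![g₀, g₁, g₂] : Fin 3 → G) l.2 else 1 with ha₀
  have ha₀0 : ∀ (q : Fin b₂ × Fin b₃) (k : Fin b₁), a₀ ((k, q.1, q.2), 0) = if (k : ℕ) = 0 then g₀ else 1 :=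
    fun q k => rfl
  have ha₀1 : ∀ (q : Fin b₁ × Fin b₃) (k : Fin b₂), a₀ ((q.1, k, q.2), 1) = if (k : ℕ) = 0 then g₁ else 1 :=
    fun q k => rfl
  have ha₀2 : ∀ (q : Fin b₁ × Fin b₂) (k : Fin b₃), a₀ ((q.1, q.2, k), 2) = if (k : ℕ) = 0 then g₂ else 1 :=
    fun q k => rfl
  -- the loop integral at `a₀` does not vanish
  have hH : ((∫ x, oneLinkWeight ρ β x ∂haarProbability G : ℝ) : ℂ) ≠ 0 :=
    Complex.ofReal_ne_zero.2 (integral_oneLinkWeight_pos ρ hρ β).ne'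
  have hloop : (∫ b, (∏ l, (oneLinkWeight ρ β (a₀ l * (b l)⁻¹) : ℂ)) * W b ∂μS) ≠ 0 := by
    have h := integral_prod_oneLinkWeight_mul_prod_trace_polyakov ρ hρ β S₀ S₁ S₂ a₀
    simp only [ha₀0, ha₀1, ha₀2] at h
    intro h0
    rw [hW] at h0
    rw [h0, mul_zero] at h
    refine (mul_ne_zero (pow_ne_zero _ hH) (mul_ne_zero (Finset.prod_ne_zero_iff.2 fun q _ => ?_)
      (mul_ne_zero (Finset.prod_ne_zero_iff.2 fun q _ => ?_) (Finset.prod_ne_zero_iff.2 fun q _ => ?_)))) h.symm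
    · subst hm₁
      rw [mgp_trace_prod_ofFn_oneLinkMatrix_mul_head]
      exact hg₀
    · subst hm₂
      rw [mgp_trace_prod_ofFn_oneLinkMatrix_mul_head]
      exact hg₁
    · subst hm₃
      rw [mgp_trace_prod_ofFn_oneLinkMatrix_mul_head]
      exact hg₂
  have hne : (∫ b, (finTorusSliceKernelTw ρ β w a₀ b : ℂ) *
      ((Real.exp (β * finTorusSpatialActionTw ρ w b / 2) : ℂ) * W b) ∂μS) ≠ 0 := by
    rw [integral_finTorusSliceKernelTw_mul_exp_mul ρ hρ β w hWc hWg a₀]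
    exact mul_ne_zero (Complex.ofReal_ne_zero.2 (Real.exp_pos _).ne') hloop
  -- continuity of `κ_w u^w_S`
  have huc : Continuous fun b : FinSpatialSite b₁ b₂ b₃ × Fin 3 → G =>
      (Real.exp (β * finTorusSpatialActionTw ρ w b / 2) : ℂ) * W b :=
    (Complex.continuous_ofReal.comp (Real.continuous_exp.comp ((continuous_const.mul
      (continuous_finTorusSpatialActionTw ρ hρ w)).div_const 2))).mul hWc
  obtain ⟨B, hB⟩ := isCompact_univ.exists_bound_of_continuousOn huc.continuousOn
  obtain ⟨C, hC⟩ := exists_norm_finTorusSliceKernelTw_le (b₁ := b₁) (b₂ := b₂) (b₃ := b₃) ρ hρ β w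
  have hKc := continuous_uncurry_finTorusSliceKernelTw (b₁ := b₁) (b₂ := b₂) (b₃ := b₃) ρ hρ β w
  have hC0 : 0 ≤ C := (norm_nonneg _).trans (hC 1 1)
  have hcont : Continuous fun a : FinSpatialSite b₁ b₂ b₃ × Fin 3 → G => ∫ b, (finTorusSliceKernelTw ρ β w a b : ℂ) *
      ((Real.exp (β * finTorusSpatialActionTw ρ w b / 2) : ℂ) * W b) ∂μS := by
    refine continuous_of_dominated (bound := fun _ => C * B) (fun a => ?_) (fun a => Eventually.of_forall fun b => ?_)
      (integrable_const _) (Eventually.of_forall fun b => ?_)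
    · exact ((Complex.continuous_ofReal.comp (hKc.comp (continuous_const.prodMk continuous_id))).mul
        huc).aestronglyMeasurable
    · rw [norm_mul, Complex.norm_real]
      exact mul_le_mul (hC a b) (hB b (Set.mem_univ b)) (norm_nonneg _) hC0
    · exact (Complex.continuous_ofReal.comp (hKc.comp (continuous_id.prodMk continuous_const))).mul continuous_const
  intro hae
  have heq := (Continuous.ae_eq_iff_eq μS hcont continuous_const).1 hae
  exact hne (congrFun heq a₀)

end MultiWitness

/-! ### Populated electric sectors at fixed magnetic flux -/

section AllFluxes

variable {G : Type*} [Group G] [TopologicalSpace G] [IsTopologicalGroup G] [CompactSpace G]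
  [MeasurableSpace G] [BorelSpace G] [SecondCountableTopology G] {N : ℕ} (ρ : G →* Matrix (Fin N) (Fin N) ℂ)
  {Γ : Type*} [AddCommGroup Γ] [Fintype Γ]

/-- **A flux sector of a magnetic sector that carries a covariant witness surviving one twisted transfer step is populated**:
for a continuous slice function `u` of flux `ψ` (`u ∘ T_{φ k} = ψ(k) · u`) with `∫ K^{w}_β(·, b) u(b) db` NOT a.e. zero,
`w = finSliceTwistTensor zM`: `0 < Re Z_{ψ,m}(M+2)` for every `M` (the kernel-level criterion
`re_fluxSector_pos_of_covariant` fed with the spectral data of the TWISTED slice kernel).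
[cite: tHooft1979Flux, §4 (4.6)–(4.10) and §5 (5.1)–(5.4)] [cite: ReedSimonIV1978, §XIII.12 Thm XIII.43] -/
theorem wilsonFinTorusMagneticFluxPartition_re_pos_of_witness (hρ : Continuous ρ)
    (hρu : ∀ g, ρ g ∈ Matrix.unitaryGroup (Fin N) ℂ) {β : ℝ} (hβ : 0 ≤ β) (zM : Fin 4 → Fin 4 → G) {φ : Γ → Fin 4 → G}
    (hφ0 : φ 0 = 1) (hφadd : ∀ k k', φ (k + k') = φ k * φ k')
    (hφc : ∀ k (i : Fin 3), φ k i.castSucc ∈ Subgroup.center G) {ψ : AddChar Γ ℂ} {b₁ b₂ b₃ : ℕ}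
    {u : (FinSpatialSite b₁ b₂ b₃ × Fin 3 → G) → ℂ} (huc : Continuous u)
    (hcov : ∀ (k : Γ) (x : FinSpatialSite b₁ b₂ b₃ × Fin 3 → G), u (finSliceTwist (φ k) x) = ψ k * u x)
    (hκu : ¬ ((fun a : FinSpatialSite b₁ b₂ b₃ × Fin 3 → G =>
        ∫ y, (finTorusSliceKernelTw ρ β (finSliceTwistTensor zM) a y : ℂ) * u y
        ∂(Measure.pi fun _ : FinSpatialSite b₁ b₂ b₃ × Fin 3 => haarProbability G))
        =ᵐ[Measure.pi fun _ : FinSpatialSite b₁ b₂ b₃ × Fin 3 => haarProbability G] 0)) (M : ℕ) :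
    0 < (wilsonFinTorusMagneticFluxPartition ρ β zM φ ψ b₁ b₂ b₃ (M + 2)).re := by
  obtain ⟨C, A, s, hcnt, b, lam, i₀, hC, hA, hb, hlam, -, -⟩ :=
    exists_eigenbasis_finTorusSliceKernelTw hρ hρu hβ (finSliceTwistTensor zM : FinSpatialSite b₁ b₂ b₃ → Fin 3 → Fin 3 → G)
  haveI : Countable s := hcnt
  have hK := stronglyMeasurable_uncurry_finTorusSliceKernelTw (b₁ := b₁) (b₂ := b₂) (b₃ := b₃) ρ hρ β
    (finSliceTwistTensor zM)
  have hsymm : ∀ x y : FinSpatialSite b₁ b₂ b₃ × Fin 3 → G,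
      finTorusSliceKernelTw ρ β (finSliceTwistTensor zM) x y = finTorusSliceKernelTw ρ β (finSliceTwistTensor zM) y x :=
    finTorusSliceKernelTw_symm ρ hρu β _
  have hT0 : (finSliceTwist (φ 0) : (FinSpatialSite b₁ b₂ b₃ × Fin 3 → G) → _) = id := by
    rw [hφ0]; exact finSliceTwist_one
  have hTadd : ∀ (k k' : Γ) (x : FinSpatialSite b₁ b₂ b₃ × Fin 3 → G),
      finSliceTwist (φ (k + k')) x = finSliceTwist (φ k) (finSliceTwist (φ k') x) := fun k k' x => by
    rw [finSliceTwist_finSliceTwist, hφadd]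
  have hT : ∀ k : Γ, MeasurePreserving (finSliceTwist (φ k) : (FinSpatialSite b₁ b₂ b₃ × Fin 3 → G) → _)
      (Measure.pi fun _ => haarProbability G) (Measure.pi fun _ => haarProbability G) :=
    fun k => measurePreserving_finSliceTwist (φ k)
  obtain ⟨B, hB⟩ := isCompact_univ.exists_bound_of_continuousOn huc.continuousOn
  exact re_fluxSector_pos_of_covariant (T := fun k => finSliceTwist (φ k)) hK hC hsymm hA hb (fun i => (hlam i).1)
    hT hT0 hTadd (z := fun k n => wilsonFinTorusTensorTwistedPartition ρ β (elecMagTwistTensor (φ k) zM) b₁ b₂ b₃ n)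
    (fun k M => wilsonFinTorusTensorTwistedPartition_elecMag_eq_integral_iterate ρ hρ β (hφc k) zM b₁ b₂ b₃ M) ψ
    huc.measurable (fun x => hB x (Set.mem_univ x)) hcov hκu M

/-- ★ **Several Polyakov lines populate the sum of their fluxes, in EVERY magnetic sector.**  For `β > 0`, a continuous unitary
`ρ` (`N ≥ 1`) of a compact metrisable group, a box with all sides `≥ 1`, an arbitrary magnetic twist tensor `zM`, central
temporal twists `φ : Γ → (Fin 4 → G)` seen by `ρ` through `ψ i` in the three spatial directions (`ρ(φ k i) = ψ_i(k)·1`), and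
finite sets `S₀, S₁, S₂` of transverse positions: **`0 < Re Z_{|S₀|ψ₀+|S₁|ψ₁+|S₂|ψ₂, m}(M+2)`** for every `M`.
[cite: tHooft1979Flux, §4 (4.6)–(4.10) and §5 (5.1)–(5.4)] [cite: MontvayMunster1994, §3.2.8 (3.184)–(3.187)] -/
theorem wilsonFinTorusMagneticFluxPartition_re_pos_of_lines (hρ : Continuous ρ)
    (hρu : ∀ g, ρ g ∈ Matrix.unitaryGroup (Fin N) ℂ) [NeZero N] {β : ℝ} (hβ : 0 < β) (zM : Fin 4 → Fin 4 → G)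
    {φ : Γ → Fin 4 → G} (hφ0 : φ 0 = 1) (hφadd : ∀ k k', φ (k + k') = φ k * φ k')
    (hφc : ∀ k (i : Fin 3), φ k i.castSucc ∈ Subgroup.center G) {ψ : Fin 3 → AddChar Γ ℂ}
    (hψ : ∀ (k : Γ) (i : Fin 3), ρ (φ k i.castSucc) = (ψ i k) • (1 : Matrix (Fin N) (Fin N) ℂ))
    {b₁ b₂ b₃ : ℕ} [NeZero b₁] [NeZero b₂] [NeZero b₃]
    (S₀ : Finset (Fin b₂ × Fin b₃)) (S₁ : Finset (Fin b₁ × Fin b₃)) (S₂ : Finset (Fin b₁ × Fin b₂)) (M : ℕ) :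
    0 < (wilsonFinTorusMagneticFluxPartition ρ β zM φ (S₀.card • ψ 0 + S₁.card • ψ 1 + S₂.card • ψ 2)
      b₁ b₂ b₃ (M + 2)).re :=
  wilsonFinTorusMagneticFluxPartition_re_pos_of_witness ρ hρ hρu hβ.le zM hφ0 hφadd hφc
    (mgp_continuous_multiWitnessTw ρ hρ β (finSliceTwistTensor zM) S₀ S₁ S₂)
    (fun k x => by
      rw [multiWitnessTw_finSliceTwist ρ (hφc k) (fun i => hψ k i) β (finSliceTwistTensor zM) S₀ S₁ S₂ x]
      simp only [AddChar.add_apply, AddChar.nsmul_apply])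
    (not_ae_eq_zero_integral_finTorusSliceKernelTw_mul_multiWitness ρ hρ hρu hβ (finSliceTwistTensor zM) S₀ S₁ S₂) M

/-- ★ **Every electric flux with enough transverse room is populated, in every magnetic sector**: for all `n₀ ≤ b₂b₃`,
`n₁ ≤ b₁b₃`, `n₂ ≤ b₁b₂`: **`0 < Re Z_{n₀ψ₀+n₁ψ₁+n₂ψ₂, m}(M+2)`** for every `M`; `β > 0`, `N ≥ 1`, all sides `≥ 1`, every `zM`.
[cite: tHooft1979Flux, §4 (4.6)–(4.10) and §5 (5.1)–(5.4)] [cite: MontvayMunster1994, §3.2.8 (3.184)–(3.187)] -/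
theorem wilsonFinTorusMagneticFluxPartition_re_pos_of_flux (hρ : Continuous ρ)
    (hρu : ∀ g, ρ g ∈ Matrix.unitaryGroup (Fin N) ℂ) [NeZero N] {β : ℝ} (hβ : 0 < β) (zM : Fin 4 → Fin 4 → G)
    {φ : Γ → Fin 4 → G} (hφ0 : φ 0 = 1) (hφadd : ∀ k k', φ (k + k') = φ k * φ k')
    (hφc : ∀ k (i : Fin 3), φ k i.castSucc ∈ Subgroup.center G) {ψ : Fin 3 → AddChar Γ ℂ}
    (hψ : ∀ (k : Γ) (i : Fin 3), ρ (φ k i.castSucc) = (ψ i k) • (1 : Matrix (Fin N) (Fin N) ℂ))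
    {b₁ b₂ b₃ : ℕ} [NeZero b₁] [NeZero b₂] [NeZero b₃] {n₀ n₁ n₂ : ℕ}
    (hn₀ : n₀ ≤ b₂ * b₃) (hn₁ : n₁ ≤ b₁ * b₃) (hn₂ : n₂ ≤ b₁ * b₂) (M : ℕ) :
    0 < (wilsonFinTorusMagneticFluxPartition ρ β zM φ (n₀ • ψ 0 + n₁ • ψ 1 + n₂ • ψ 2) b₁ b₂ b₃ (M + 2)).re := by
  obtain ⟨S₀, -, hS₀⟩ := Finset.exists_subset_card_eq (s := (Finset.univ : Finset (Fin b₂ × Fin b₃)))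
    (n := n₀) (by simpa [Finset.card_univ] using hn₀)
  obtain ⟨S₁, -, hS₁⟩ := Finset.exists_subset_card_eq (s := (Finset.univ : Finset (Fin b₁ × Fin b₃)))
    (n := n₁) (by simpa [Finset.card_univ] using hn₁)
  obtain ⟨S₂, -, hS₂⟩ := Finset.exists_subset_card_eq (s := (Finset.univ : Finset (Fin b₁ × Fin b₂)))
    (n := n₂) (by simpa [Finset.card_univ] using hn₂)
  rw [← hS₀, ← hS₁, ← hS₂]
  exact wilsonFinTorusMagneticFluxPartition_re_pos_of_lines ρ hρ hρu hβ zM hφ0 hφadd hφc hψ S₀ S₁ S₂ M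

omit [TopologicalSpace G] [IsTopologicalGroup G] [CompactSpace G] [MeasurableSpace G] [BorelSpace G]
  [SecondCountableTopology G] in
/-- Every character of the finite group `Γ` has positive additive order. [folklore] -/
private theorem mgp_addOrderOf_addChar_pos (ψ : AddChar Γ ℂ) : 0 < addOrderOf ψ := by
  refine (isOfFinAddOrder_iff_nsmul_eq_zero.2 ⟨Fintype.card Γ, Fintype.card_pos, ?_⟩).addOrderOf_pos
  ext k
  rw [AddChar.nsmul_apply, ← AddChar.map_nsmul_eq_pow, card_nsmul_eq_zero, AddChar.map_zero_eq_one, AddChar.zero_apply]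

/-- ★ **Every electric flux in the lattice generated by the seen characters is populated in every magnetic sector, given
room**: if `ord(ψ₀) ≤ b₂b₃ + 1`, `ord(ψ₁) ≤ b₁b₃ + 1`, `ord(ψ₂) ≤ b₁b₂ + 1`, then every `χ` in the subgroup of `Γ̂` generated
by `ψ₀, ψ₁, ψ₂` has `0 < Re Z_{χ,m}(M+2)` for all `M` and EVERY magnetic twist tensor `zM` — for `SU(N)`, the fundamental `ρ`
and 't Hooft's centre twists: every `(e, m)`. [cite: tHooft1979Flux, §4 (4.5)–(4.10) and §5 (5.1)–(5.4)] -/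
theorem wilsonFinTorusMagneticFluxPartition_re_pos_of_mem_closure (hρ : Continuous ρ)
    (hρu : ∀ g, ρ g ∈ Matrix.unitaryGroup (Fin N) ℂ) [NeZero N] {β : ℝ} (hβ : 0 < β) (zM : Fin 4 → Fin 4 → G)
    {φ : Γ → Fin 4 → G} (hφ0 : φ 0 = 1) (hφadd : ∀ k k', φ (k + k') = φ k * φ k')
    (hφc : ∀ k (i : Fin 3), φ k i.castSucc ∈ Subgroup.center G) {ψ : Fin 3 → AddChar Γ ℂ}
    (hψ : ∀ (k : Γ) (i : Fin 3), ρ (φ k i.castSucc) = (ψ i k) • (1 : Matrix (Fin N) (Fin N) ℂ))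
    {b₁ b₂ b₃ : ℕ} [NeZero b₁] [NeZero b₂] [NeZero b₃] (h₀ : addOrderOf (ψ 0) ≤ b₂ * b₃ + 1)
    (h₁ : addOrderOf (ψ 1) ≤ b₁ * b₃ + 1) (h₂ : addOrderOf (ψ 2) ≤ b₁ * b₂ + 1) {χ : AddChar Γ ℂ}
    (hχ : χ ∈ AddSubgroup.closure (Set.range ψ)) (M : ℕ) :
    0 < (wilsonFinTorusMagneticFluxPartition ρ β zM φ χ b₁ b₂ b₃ (M + 2)).re := by
  obtain ⟨z, rfl⟩ := AddSubgroup.mem_closure_range_iff_of_fintype.1 hχ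
  have hord : ∀ i, (0 : ℤ) < (addOrderOf (ψ i) : ℤ) := fun i => Int.natCast_pos.2 (mgp_addOrderOf_addChar_pos (ψ i))
  set n : Fin 3 → ℕ := fun i => (z i % (addOrderOf (ψ i) : ℤ)).toNat with hn
  have hnz : ∀ i, (n i : ℤ) = z i % (addOrderOf (ψ i) : ℤ) := fun i =>
    Int.toNat_of_nonneg (Int.emod_nonneg _ (hord i).ne')
  have hnlt : ∀ i, n i < addOrderOf (ψ i) := fun i => by
    have h := Int.emod_lt_of_pos (z i) (hord i)
    rw [← hnz i] at h
    exact_mod_cast h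
  have hzn : ∀ i, z i • ψ i = n i • ψ i := fun i => by
    rw [← natCast_zsmul, hnz i, mod_addOrderOf_zsmul]
  have hsum : ∑ i, z i • ψ i = n 0 • ψ 0 + n 1 • ψ 1 + n 2 • ψ 2 := by
    simp only [hzn, Fin.sum_univ_three]
  rw [hsum]
  exact wilsonFinTorusMagneticFluxPartition_re_pos_of_flux ρ hρ hρu hβ zM hφ0 hφadd hφc hψ
    (by have := hnlt 0; omega) (by have := hnlt 1; omega) (by have := hnlt 2; omega) M

end AllFluxes

/-! ### 't Hooft's `e^{−βF(e, m; a, β)} > 0`: every electric flux seen by `ρ` is populated in every magnetic sector -/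

section Transform

variable {G : Type*} [Group G] [TopologicalSpace G] [IsTopologicalGroup G] [CompactSpace G]
  [MeasurableSpace G] [BorelSpace G] [SecondCountableTopology G] {N : ℕ} (ρ : G →* Matrix (Fin N) (Fin N) ℂ)
  {Γ : Type*} [AddCommGroup Γ] [Fintype Γ]

omit [Fintype Γ] in
/-- The triple character is additive in its three slots: `(ψ₀,ψ₁,ψ₂) = (ψ₀,0,0) + (0,ψ₁,0) + (0,0,ψ₂)` (Mathlib's additive
notation for the pointwise product of characters). [cite: tHooft1979Flux, §4 (4.5)] -/
theorem tripleFluxChar_eq_add (ψ₀ ψ₁ ψ₂ : AddChar Γ ℂ) :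
    tripleFluxChar ψ₀ ψ₁ ψ₂ = tripleFluxChar ψ₀ 0 0 + tripleFluxChar 0 ψ₁ 0 + tripleFluxChar 0 0 ψ₂ := by
  ext k
  simp [AddChar.add_apply]

omit [Fintype Γ] in
/-- Multiples in the three slots: `(n₀•χ, n₁•χ, n₂•χ) = n₀•(χ,0,0) + n₁•(0,χ,0) + n₂•(0,0,χ)`. [cite: tHooft1979Flux, §4 (4.5)] -/
theorem tripleFluxChar_nsmul (χ : AddChar Γ ℂ) (n₀ n₁ n₂ : ℕ) :
    tripleFluxChar (n₀ • χ) (n₁ • χ) (n₂ • χ) =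
      n₀ • tripleFluxChar χ 0 0 + n₁ • tripleFluxChar 0 χ 0 + n₂ • tripleFluxChar 0 0 χ := by
  ext k
  simp [AddChar.add_apply, AddChar.nsmul_apply]

omit [Fintype Γ] in
/-- Integer multiples in the three slots. [cite: tHooft1979Flux, §4 (4.5)] -/
theorem tripleFluxChar_zsmul (χ : AddChar Γ ℂ) (z₀ z₁ z₂ : ℤ) :
    tripleFluxChar (z₀ • χ) (z₁ • χ) (z₂ • χ) =
      z₀ • tripleFluxChar χ 0 0 + z₁ • tripleFluxChar 0 χ 0 + z₂ • tripleFluxChar 0 0 χ := by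
  have h0 : tripleFluxChar (0 : AddChar Γ ℂ) 0 0 = 0 := (tripleFluxChar_eq_zero_iff 0 0 0).2 ⟨rfl, rfl, rfl⟩
  -- the three slot maps are additive, hence commute with integer multiples
  let f₀ : AddChar Γ ℂ →+ AddChar (Γ × Γ × Γ) ℂ :=
    { toFun := fun ψ => tripleFluxChar ψ 0 0, map_zero' := h0,
      map_add' := fun ψ ψ' => by ext k; simp [AddChar.add_apply] }
  let f₁ : AddChar Γ ℂ →+ AddChar (Γ × Γ × Γ) ℂ :=
    { toFun := fun ψ => tripleFluxChar 0 ψ 0, map_zero' := h0,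
      map_add' := fun ψ ψ' => by ext k; simp [AddChar.add_apply] }
  let f₂ : AddChar Γ ℂ →+ AddChar (Γ × Γ × Γ) ℂ :=
    { toFun := fun ψ => tripleFluxChar 0 0 ψ, map_zero' := h0,
      map_add' := fun ψ ψ' => by ext k; simp [AddChar.add_apply] }
  have hslot : ∀ (z : ℤ), tripleFluxChar (z • χ) 0 0 = z • tripleFluxChar χ 0 0 ∧
      tripleFluxChar 0 (z • χ) 0 = z • tripleFluxChar 0 χ 0 ∧ tripleFluxChar 0 0 (z • χ) = z • tripleFluxChar 0 0 χ :=
    fun z => ⟨map_zsmul f₀ z χ, map_zsmul f₁ z χ, map_zsmul f₂ z χ⟩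
  rw [tripleFluxChar_eq_add, (hslot z₀).1, (hslot z₁).2.1, (hslot z₂).2.2]

/-- The slot characters have order at most that of `χ` (plumbing for the room hypotheses). [folklore] -/
private theorem mgp_addOrderOf_slot_le (χ : AddChar Γ ℂ) :
    addOrderOf (tripleFluxChar χ 0 0) ≤ addOrderOf χ ∧ addOrderOf (tripleFluxChar 0 χ 0) ≤ addOrderOf χ ∧
      addOrderOf (tripleFluxChar 0 0 χ) ≤ addOrderOf χ := by
  have hpos : 0 < addOrderOf χ := by
    refine (isOfFinAddOrder_iff_nsmul_eq_zero.2 ⟨Fintype.card Γ, Fintype.card_pos, ?_⟩).addOrderOf_pos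
    ext k
    rw [AddChar.nsmul_apply, ← AddChar.map_nsmul_eq_pow, card_nsmul_eq_zero, AddChar.map_zero_eq_one, AddChar.zero_apply]
  have hχ : addOrderOf χ • χ = 0 := addOrderOf_nsmul_eq_zero χ
  have h := tripleFluxChar_nsmul χ (addOrderOf χ) (addOrderOf χ) (addOrderOf χ)
  rw [hχ] at h
  have h0 : tripleFluxChar (0 : AddChar Γ ℂ) 0 0 = 0 := (tripleFluxChar_eq_zero_iff 0 0 0).2 ⟨rfl, rfl, rfl⟩
  refine ⟨addOrderOf_le_of_nsmul_eq_zero hpos ?_, addOrderOf_le_of_nsmul_eq_zero hpos ?_,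
    addOrderOf_le_of_nsmul_eq_zero hpos ?_⟩
  · have h1 := tripleFluxChar_nsmul χ (addOrderOf χ) 0 0
    rw [hχ, zero_nsmul, zero_nsmul, zero_nsmul, add_zero, add_zero, h0] at h1
    exact h1.symm
  · have h1 := tripleFluxChar_nsmul χ 0 (addOrderOf χ) 0
    rw [hχ, zero_nsmul, zero_nsmul, zero_nsmul, zero_add, add_zero, h0] at h1
    exact h1.symm
  · have h1 := tripleFluxChar_nsmul χ 0 0 (addOrderOf χ)
    rw [hχ, zero_nsmul, zero_nsmul, zero_nsmul, zero_add, zero_add, h0] at h1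
    exact h1.symm

omit [TopologicalSpace G] [IsTopologicalGroup G] [CompactSpace G] [MeasurableSpace G] [BorelSpace G]
  [SecondCountableTopology G] [Fintype Γ] in
/-- The three-slot twist family `k ↦ ![φ k₀, φ k₁, φ k₂, 1]` of a hom-like centre-valued `φ` seen by `ρ` through `χ` is a
central hom-like family seen through the slot characters (plumbing). [cite: tHooft1979Flux, §4 (4.2)–(4.5)] -/
private theorem mgp_tripleTwist_hom {φ : Γ → G} (hφ0 : φ 0 = 1) (hφadd : ∀ k k', φ (k + k') = φ k * φ k')
    (hφc : ∀ k, φ k ∈ Subgroup.center G) {χ : AddChar Γ ℂ}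
    (hχ : ∀ k, ρ (φ k) = (χ k) • (1 : Matrix (Fin N) (Fin N) ℂ)) :
    (fun k : Γ × Γ × Γ => (![φ k.1, φ k.2.1, φ k.2.2, 1] : Fin 4 → G)) 0 = 1 ∧
      (∀ k k' : Γ × Γ × Γ, (![φ (k + k').1, φ (k + k').2.1, φ (k + k').2.2, 1] : Fin 4 → G) =
        ![φ k.1, φ k.2.1, φ k.2.2, 1] * ![φ k'.1, φ k'.2.1, φ k'.2.2, 1]) ∧
      (∀ (k : Γ × Γ × Γ) (i : Fin 3), (![φ k.1, φ k.2.1, φ k.2.2, 1] : Fin 4 → G) i.castSucc ∈ Subgroup.center G) ∧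
      ∀ (k : Γ × Γ × Γ) (i : Fin 3), ρ ((![φ k.1, φ k.2.1, φ k.2.2, 1] : Fin 4 → G) i.castSucc) =
        ((![tripleFluxChar χ 0 0, tripleFluxChar 0 χ 0, tripleFluxChar 0 0 χ] : Fin 3 → AddChar (Γ × Γ × Γ) ℂ) i k) •
          (1 : Matrix (Fin N) (Fin N) ℂ) := by
  refine ⟨?_, fun k k' => ?_, fun k i => ?_, fun k i => ?_⟩
  · funext μ
    fin_cases μ <;> simp [hφ0]
  · funext μ
    fin_cases μ <;> simp [hφadd]
  · fin_cases i
    · exact hφc _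
    · exact hφc _
    · exact hφc _
  · fin_cases i <;> simp [hχ]

/-- ★ **'t HOOFT's `e^{−βF(e, m; a, β)} > 0` FOR EVERY ELECTRIC FLUX SEEN BY `ρ`, IN EVERY MAGNETIC SECTOR.**  For `β > 0`, a
continuous unitary `ρ` (`N ≥ 1`) of a compact metrisable `G`, a finite abelian `Γ` with a hom-like centre-valued twist map `φ`
seen by `ρ` through the character `χ` (`ρ(φ k) = χ(k)·1`; for `SU(N)`, the fundamental `ρ` and `ℤ_N → Z(SU(N))`, `χ` generates
`ℤ̂_N`), every box `a × b × c` with sides `≥ 1`, all `n₀ ≤ bc`, `n₁ ≤ ac`, `n₂ ≤ ab` and EVERY magnetic flux `(m₁₂, m₀₂, m₀₁)`: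
**`0 < Re e^{−F}(n₀χ, n₁χ, n₂χ | m₁₂, m₀₂, m₀₁; a, b, c, M+2)`** for every `M` (`n_i` parallel Polyakov lines in direction `i`
create the electric flux, 't Hooft (4.10), whatever the magnetic flux). [cite: tHooft1979Flux, §4 (4.6)–(4.10) and §5 (5.1)–(5.4)]
[cite: MontvayMunster1994, §3.2.8 (3.184)–(3.187)] -/
theorem wilsonFinTorusFluxTransform_re_pos_of_flux (hρ : Continuous ρ)
    (hρu : ∀ g, ρ g ∈ Matrix.unitaryGroup (Fin N) ℂ) [NeZero N] {β : ℝ} (hβ : 0 < β) {φ : Γ → G} (hφ0 : φ 0 = 1)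
    (hφadd : ∀ k k', φ (k + k') = φ k * φ k') (hφc : ∀ k, φ k ∈ Subgroup.center G) {χ : AddChar Γ ℂ}
    (hχ : ∀ k, ρ (φ k) = (χ k) • (1 : Matrix (Fin N) (Fin N) ℂ)) (m₁₂ m₀₂ m₀₁ : Γ)
    {a b c : ℕ} [NeZero a] [NeZero b] [NeZero c] {n₀ n₁ n₂ : ℕ} (hn₀ : n₀ ≤ b * c) (hn₁ : n₁ ≤ a * c)
    (hn₂ : n₂ ≤ a * b) (M : ℕ) :
    0 < (wilsonFinTorusFluxTransform ρ β φ (n₀ • χ) (n₁ • χ) (n₂ • χ) m₁₂ m₀₂ m₀₁ a b c (M + 2)).re := by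
  obtain ⟨h0, hadd, hc, hseen⟩ := mgp_tripleTwist_hom ρ hφ0 hφadd hφc hχ
  rw [wilsonFinTorusFluxTransform_eq_magneticFluxPartition ρ β hφ0, tripleFluxChar_nsmul]
  have h := wilsonFinTorusMagneticFluxPartition_re_pos_of_flux ρ hρ hρu hβ
    (fun μ ν => φ (twistIdx (0 : Γ) 0 0 m₁₂ m₀₂ m₀₁ μ ν)) h0 hadd hc hseen hn₀ hn₁ hn₂ M
  simpa using h

/-- ★ **Every electric flux generated by the seen character is populated in every magnetic sector, given room**: with
`ord χ ≤ bc + 1`, `ord χ ≤ ac + 1`, `ord χ ≤ ab + 1` (e.g. all of `ab, ac, bc ≥ N − 1` for `SU(N)`), for all `ψ₀, ψ₁, ψ₂` in the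
subgroup generated by `χ` and EVERY magnetic flux: `0 < Re e^{−F}(ψ₀, ψ₁, ψ₂ | m₁₂, m₀₂, m₀₁; a, b, c, M+2)` — for `SU(N)`,
the fundamental `ρ`, 't Hooft's centre twists: EVERY `(e, m) ∈ ℤ_N³ × ℤ_N³`. [cite: tHooft1979Flux, §4 (4.5)–(4.10) and §5 (5.1)–(5.4)] -/
theorem wilsonFinTorusFluxTransform_re_pos_of_mem_closure (hρ : Continuous ρ)
    (hρu : ∀ g, ρ g ∈ Matrix.unitaryGroup (Fin N) ℂ) [NeZero N] {β : ℝ} (hβ : 0 < β) {φ : Γ → G} (hφ0 : φ 0 = 1)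
    (hφadd : ∀ k k', φ (k + k') = φ k * φ k') (hφc : ∀ k, φ k ∈ Subgroup.center G) {χ : AddChar Γ ℂ}
    (hχ : ∀ k, ρ (φ k) = (χ k) • (1 : Matrix (Fin N) (Fin N) ℂ)) (m₁₂ m₀₂ m₀₁ : Γ)
    {a b c : ℕ} [NeZero a] [NeZero b] [NeZero c] (hbc : addOrderOf χ ≤ b * c + 1) (hac : addOrderOf χ ≤ a * c + 1)
    (hab : addOrderOf χ ≤ a * b + 1) {ψ₀ ψ₁ ψ₂ : AddChar Γ ℂ}
    (hψ₀ : ψ₀ ∈ AddSubgroup.closure ({χ} : Set (AddChar Γ ℂ)))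
    (hψ₁ : ψ₁ ∈ AddSubgroup.closure ({χ} : Set (AddChar Γ ℂ)))
    (hψ₂ : ψ₂ ∈ AddSubgroup.closure ({χ} : Set (AddChar Γ ℂ))) (M : ℕ) :
    0 < (wilsonFinTorusFluxTransform ρ β φ ψ₀ ψ₁ ψ₂ m₁₂ m₀₂ m₀₁ a b c (M + 2)).re := by
  obtain ⟨h0, hadd, hc, hseen⟩ := mgp_tripleTwist_hom ρ hφ0 hφadd hφc hχ
  obtain ⟨z₀, rfl⟩ := AddSubgroup.mem_closure_singleton.1 hψ₀
  obtain ⟨z₁, rfl⟩ := AddSubgroup.mem_closure_singleton.1 hψ₁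
  obtain ⟨z₂, rfl⟩ := AddSubgroup.mem_closure_singleton.1 hψ₂
  obtain ⟨hle₀, hle₁, hle₂⟩ := mgp_addOrderOf_slot_le (Γ := Γ) χ
  rw [wilsonFinTorusFluxTransform_eq_magneticFluxPartition ρ β hφ0, tripleFluxChar_zsmul]
  have hmem : z₀ • tripleFluxChar χ 0 0 + z₁ • tripleFluxChar 0 χ 0 + z₂ • tripleFluxChar 0 0 χ ∈
      AddSubgroup.closure (Set.range
        (![tripleFluxChar χ 0 0, tripleFluxChar 0 χ 0, tripleFluxChar 0 0 χ] : Fin 3 → AddChar (Γ × Γ × Γ) ℂ)) := by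
    refine AddSubgroup.add_mem _ (AddSubgroup.add_mem _ ?_ ?_) ?_
    · exact AddSubgroup.zsmul_mem _ (AddSubgroup.subset_closure (Set.mem_range_self (0 : Fin 3))) _
    · exact AddSubgroup.zsmul_mem _ (AddSubgroup.subset_closure (Set.mem_range_self (1 : Fin 3))) _
    · exact AddSubgroup.zsmul_mem _ (AddSubgroup.subset_closure (Set.mem_range_self (2 : Fin 3))) _
  refine wilsonFinTorusMagneticFluxPartition_re_pos_of_mem_closure ρ hρ hρu hβ
    (fun μ ν => φ (twistIdx (0 : Γ) 0 0 m₁₂ m₀₂ m₀₁ μ ν)) h0 hadd hc hseen ?_ ?_ ?_ hmem M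
  · simpa using hle₀.trans hbc
  · simpa using hle₁.trans hac
  · simpa using hle₂.trans hab

end Transform

end Literature.MathematicalPhysics.QuantumFieldTheory

end
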